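import Summits.QuantumFields.BalabanUV.T4Continuum.Support.NE7EtaBackgroundReferenceWitness
import HarnessLib

/-!
# NE7EtaBackgroundEnergyClass — route #1 of the NE7 crux, stub S7 (NODE O, the BACKGROUND COORDINATE): the (A)-bill's (H∃) RE-CUT FROM
# SUP-FORM TO ENERGY-CLASS (ℓ²) REGULARITY — `RegularSup b c` → `Regular b g`; the letters `c`, `gradConst 4 c ≤ g` GONE; at `b = ε` the
# hypothesis is ONE `ℓ²` inequality on the covariant gradient of the minimiser's flux

Cell `pub-balaban`, rung (B)+1 sub-cell t4, lineage `b2b-balaban-t4-ne7-p1`, generation 61 (CRUX PROVER NE7 #1, ruling e34b3e0c (2)); crux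
skeleton `t4/skeletons/NE7-CRUX-R1.md` v1.7.18 §0bis item 7 ∕ §2.  HONEST FRAMING (page 1): FIXED FINITE T⁴, rung (B)+1; NE7, NE3 NOT PRINTED in
[Balaban1984PropagatorsI]–[Balaban1989LargeFieldII] and NOT PROVED here; continuum YM on T⁴ ⇐ BetaPertH ∧ nine spine estimates (0/9 proved);
BetaPertH ⇐ (D1) ∧ (D4) ∧ CAP+tail; G-an2-4 gates asym, D1 and NE2/3/4; NOT infinite volume, NOT mass gap, NOT Clay.

THE LOCATED FACT ([folklore], about OUR chain).  From `NE7EtaBackgroundCloseness.hclose_of_covRoot_occ` (p258604) upward, the background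
coordinate reads the run-`(K+1)` minimiser ONLY through the `ℓ²` shape `MinimalActionRate.Regular 4 L N b g (K+1)` (binders `hexA`∕`hexB`;
the torus-gauge letter `NE7EtaBackgroundGaugeLetterDischarge.hletter_holds` also asks `Regular`).  The (H∃) binder of record
`hmin : ∀ V ∈ dom, ∀ k, ∃ U, IsMinimiser 4 (sfClass 4 L N ε) L N k V U ∧ RegularSup 4 L N b c k U` (p312789 → p314477 → p317084 → p317648),
chosen to be VERBATIM the binder of row NE3's END `MinimalActionThm1Type.actionRate_sfClass_thm1Type`, is consumed in the whole route-1 chain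
only through `RegularSup.regular` ∘ `Regular.mono` (`NE7EtaBackgroundOfRegularMinimisers.hexB_of_hmin`, `NE7EtaBackgroundAllCutoffs` ll.157–166):
its POINTWISE clause `‖∇_U F‖ ≤ c·(L^k)^{−3}` ([Balaban1985Variational] Thm 1 (10) TYPE) is VESTIGIAL for NE7.  THIS FILE re-cuts on
  (H∃)ᴱ  `hminE : ∀ V ∈ dom, ∀ k, ∃ U, IsMinimiser 4 (sfClass 4 L N ε) L N k V U ∧ Regular 4 L N b g k U`
— a minimiser whose flux has covariant-gradient ENERGY `Σ_{period} ‖∇_U F‖² ≤ g·N⁴·(L^k)⁴∕(L^k)⁶` (Thm 1 (8) + an `H¹`-type bound, read in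
`ℓ²`; a hypothesis SHAPE of ours, asserted for no configuration):
 * §1 the shape and its FEEDERS: `hminE_of_hmin` (THE OLD BILL IMPLIES THE NEW, `gradConst 4 c ≤ g`); `regular_of_mem_sfClass` ∕
   `hminE_of_gradFluxSq` (at `b = ε` the class clauses of `Regular` are FREE for admissible configurations, so (H∃)ᴱ is ONE inequality
   `gradFluxSq U (periodBox (N·L^k)) ≤ g·N^d·(L^k)^d∕(L^k)⁶` per level); `hminE_of_apriori` (existence DISCHARGED by compactness,
   `MinimalActionExistence.exists_isMinimiser_of_nonempty`, given non-empty admissible sets and an a-priori energy bound for minimisers —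
   the universal a-priori form, labelled stronger than (H∃)ᴱ);
 * §2 `hexA_of_hminE`, `hexB_of_hminE`, **`hclose_of_hminE`** — `hclose_of_hmin` (p312789) on (H∃)ᴱ with `0 ≤ g` explicit, conclusion VERBATIM;
 * §3 **`hclose_of_hminE_ref`** — `NE7EtaBackgroundReferenceWitness.hclose_of_hmin_ref` (p314477) on (H∃)ᴱ, conclusion VERBATIM.
The all-cutoffs selection, the END's four background binders and the docked END on (H∃)ᴱ follow in `NE7EtaBackgroundEnergyClassAllCutoffs` ∕
`NE7Route1EndDockedEnergy`.  WHY IT MATTERS (our remark, no printed claim): for NE7 the regularity currency of the constrained Wilson minimiser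
is the `ℓ²` norm of `∇_U F` — by a Weitzenböck-type identity on the torus, the `ℓ²` norm of the constrained Yang–Mills tension `∇_U^* F` up to
`O(sup‖F‖·Σ‖F‖²)` — an ENERGY-class statement, not the Schauder-class pointwise bound (10); row NE3's own action-rate road still reads (10)
through its kinematic refinement (`MinimalActionRefine.SmoothRefine`), which this file does not touch.  Nothing in NE3's covariant root (X-A4)
changes; route 1 stays KERNEL-COMPLETE AT FORM LEVEL ∕ DEPENDENT; NE7 NOT proved.  0 def; 0 sorry.
-/

set_option autoImplicit false

open scoped BigOperators Matrix Matrix.Norms.L2Operator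
open Finset NormedSpace

namespace Summit.QuantumFields.BalabanUV.T4Continuum.NE7EtaBackgroundEnergyClass

open Literature.MathematicalPhysics.QuantumFieldTheory.Balaban1983to89
open B7Prop1Explicit B7Prop2Explicit
open T4AveragingDeficitWall hiding Site Plane Plaq Bond
open T4AveragingDeficitWallBoundary (periodBox IsPeriodicCfg)
open MinimalActionSandwich (IsMinimiser admissible)
open MinimalActionRate (Regular sfClass)
open MinimalActionRefine (RegularSup gradConst gradConst_nonneg)
open MinimalActionExistence (exists_isMinimiser_of_nonempty)
open AveragingDeficitPeriodicCounting (IsPeriodicDir)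
open AveragingDeficitTwoLevelPrep (twoLevelSmall)
open AveragingDeficitMultiLevelPrep (LevelSmall)
open NE3EnergyShapes (residualScale residualScale_nonneg IsUnitarySite IsPeriodicSite)
open NE3EnergyWeightedShapes (energyNormW)
open AveragingDeficitDualResidual (dualC1 dualC2)
open AveragingDeficitDerivWallProof (wallConst)
open NE7EtaBackgroundCarrier NE7EtaBackgroundCloseness
open TorusSmallFieldGlobalGauge (sectorConst gaugeConst sectorConst_pos)
open NE7EtaBackgroundGaugeLetterDischarge (hletter_holds)
open NE7EtaBackgroundLevelSmallDischarge (levelSmall_hls)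
open NE7EtaBackgroundReferenceWitness (covRoot_mono gauge_refPair)

noncomputable section

/-! ## §1 The energy-class (H∃)ᴱ and its feeders -/

section Shape

variable {d : ℕ} {n : Type*} [Fintype n] [DecidableEq n]

/-- **THE OLD BILL IMPLIES THE NEW**: sup-form (H∃) `hmin` (`RegularSup b c`, p312789's binder) gives the energy-class (H∃)ᴱ with `Regular b g`
for every `g ≥ gradConst d c` (`RegularSup.regular`, `Regular.mono`). [folklore] -/
theorem hminE_of_hmin {L N : ℕ} {ε b c g : ℝ} (hgc : gradConst d c ≤ g) {dom : Set (Site d → Fin d → (Matrix n n ℂ)ˣ)}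
    (hmin : ∀ V ∈ dom, ∀ k : ℕ, ∃ U, IsMinimiser d (sfClass d L N ε) L N k V U ∧ RegularSup d L N b c k U) :
    ∀ V ∈ dom, ∀ k : ℕ, ∃ U, IsMinimiser d (sfClass d L N ε) L N k V U ∧ Regular d L N b g k U :=
  fun V hV k => (hmin V hV k).imp fun _ h => ⟨h.1, (h.2.regular).mono le_rfl hgc⟩

/-- **AT `b = ε` THE CLASS CLAUSES OF `Regular` ARE FREE**: a configuration of `sfClass d L N ε k` (unitary, `(N·L^k)`-periodic, small field
of radius `ε·(L^k)^{−2}`) with flux covariant-gradient energy `gradFluxSq U (periodBox (N·L^k)) ≤ g·N^d·(L^k)^d∕(L^k)⁶` is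
`Regular d L N ε g k U`. [folklore] -/
theorem regular_of_mem_sfClass {L N k : ℕ} {ε g : ℝ} {U : Site d → Fin d → (Matrix n n ℂ)ˣ} (hU : U ∈ sfClass d L N ε k)
    (hgrad : gradFluxSq U (periodBox (N * L ^ k)) ≤ g * (N : ℝ) ^ d * ((L : ℝ) ^ k) ^ d / ((L : ℝ) ^ k) ^ 6) :
    Regular d L N ε g k U :=
  ⟨hU.1, hU.2.1, hU.2.2, hgrad⟩

/-- Conversely a `Regular d L N b g k` configuration lies in `sfClass d L N b k` and obeys the energy inequality. [folklore] -/
theorem mem_sfClass_of_regular {L N k : ℕ} {b g : ℝ} {U : Site d → Fin d → (Matrix n n ℂ)ˣ} (h : Regular d L N b g k U) :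
    U ∈ sfClass d L N b k ∧ gradFluxSq U (periodBox (N * L ^ k)) ≤ g * (N : ℝ) ^ d * ((L : ℝ) ^ k) ^ d / ((L : ℝ) ^ k) ^ 6 :=
  ⟨⟨h.unitary, h.periodic, h.small⟩, h.grad⟩

/-- **(H∃)ᴱ AT `b = ε` IS ONE `ℓ²` INEQUALITY PER LEVEL**: if for every datum of `dom` and every level SOME minimiser of run `k` over
`sfClass d L N ε` has `gradFluxSq U (periodBox (N·L^k)) ≤ g·N^d·(L^k)^d∕(L^k)⁶`, then (H∃)ᴱ holds with `b = ε` (the minimiser is admissible,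
hence in the class). [folklore] -/
theorem hminE_of_gradFluxSq {L N : ℕ} {ε g : ℝ} {dom : Set (Site d → Fin d → (Matrix n n ℂ)ˣ)}
    (h : ∀ V ∈ dom, ∀ k : ℕ, ∃ U, IsMinimiser d (sfClass d L N ε) L N k V U ∧
      gradFluxSq U (periodBox (N * L ^ k)) ≤ g * (N : ℝ) ^ d * ((L : ℝ) ^ k) ^ d / ((L : ℝ) ^ k) ^ 6) :
    ∀ V ∈ dom, ∀ k : ℕ, ∃ U, IsMinimiser d (sfClass d L N ε) L N k V U ∧ Regular d L N ε g k U :=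
  fun V hV k => (h V hV k).imp fun _ hU => ⟨hU.1, regular_of_mem_sfClass hU.1.mem.1 hU.2⟩

/-- **(H∃)ᴱ FROM NON-EMPTINESS AND AN A-PRIORI ENERGY BOUND** (existence DISCHARGED by compactness): in the regime of
`MinimalActionExistence.exists_isMinimiser_of_nonempty` (`L ≥ 2`, `0 ≤ ε`, `16·C₀·ε ≤ 3`, `1024(d+1)(d+4)L²ε ≤ 1`), if every admissible set
`admissible (sfClass d L N ε) L k V`, `V ∈ dom`, is non-empty and EVERY minimiser obeys the a-priori bound
`gradFluxSq U (periodBox (N·L^k)) ≤ g·N^d·(L^k)^d∕(L^k)⁶`, then (H∃)ᴱ holds with `b = ε`.  (The universal a-priori form is STRONGER than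
(H∃)ᴱ, which asks it of one minimiser per level; both are hypothesis SHAPES asserted for nothing here.) [folklore] -/
theorem hminE_of_apriori [Nonempty n] {L N : ℕ} (hL : 2 ≤ L) {ε g : ℝ} (hε0 : 0 ≤ ε) (hε1 : 16 * C0 d * ε ≤ 3)
    (hε2 : 1024 * (d + 1) * (d + 4) * (L : ℝ) ^ 2 * ε ≤ 1) {dom : Set (Site d → Fin d → (Matrix n n ℂ)ˣ)}
    (hne : ∀ V ∈ dom, ∀ k : ℕ, (admissible (sfClass d L N ε) L k V).Nonempty)
    (hap : ∀ V ∈ dom, ∀ (k : ℕ) (U : Site d → Fin d → (Matrix n n ℂ)ˣ), IsMinimiser d (sfClass d L N ε) L N k V U →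
      gradFluxSq U (periodBox (N * L ^ k)) ≤ g * (N : ℝ) ^ d * ((L : ℝ) ^ k) ^ d / ((L : ℝ) ^ k) ^ 6) :
    ∀ V ∈ dom, ∀ k : ℕ, ∃ U, IsMinimiser d (sfClass d L N ε) L N k V U ∧ Regular d L N ε g k U := by
  refine hminE_of_gradFluxSq fun V hV k => ?_
  obtain ⟨U, hU⟩ := exists_isMinimiser_of_nonempty (N := N) hL hε0 hε1 hε2 (hne V hV k)
  exact ⟨U, hU, hap V hV k U hU⟩

end Shape

variable {n : Type} [Fintype n] [DecidableEq n] [Nonempty n]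

/-! ## §2 The two existence binders of p258604 and the `hclose` binder, from (H∃)ᴱ -/

omit [Nonempty n] in
/-- **`hexA` FROM (H∃)ᴱ**: run-A minimisers exist at every level for every datum of `dom` (the regularity conjunct is dropped). [folklore] -/
theorem hexA_of_hminE {L N : ℕ} {ε b g : ℝ} {dom : Set (Site 4 → Fin 4 → (Matrix n n ℂ)ˣ)}
    (hminE : ∀ V ∈ dom, ∀ k : ℕ, ∃ U, IsMinimiser 4 (sfClass 4 L N ε) L N k V U ∧ Regular 4 L N b g k U) :
    ∀ K : ℕ, 1 ≤ K → ∀ v ∈ dom, ∃ UA : Site 4 → Fin 4 → (Matrix n n ℂ)ˣ, IsMinimiser 4 (sfClass 4 L N ε) L N K v UA := by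
  intro K _ v hv
  obtain ⟨U, hU, -⟩ := hminE v hv K
  exact ⟨U, hU⟩

/-- **`hexB` FROM (H∃)ᴱ AND THE TORUS GAUGE** (`L ≥ 2`, `N ≥ 1`, `θ⁶ = L⁻¹`, `0 ≤ b ≤ ε`): for `K ≥ 1` and `v ∈ dom`, under the sector
condition `|n|·N²·ε ≤ sectorConst n`, the energy-class run-`(K+1)` minimiser of `hminE` is, in SOME unitary `N·L^{K+1}`-periodic gauge,
bondwise `exp A_B` with `‖A_B‖ ≤ gaugeConst n·(N⁻¹ + N·b)·θ^{6(K+1)}` (`NE7EtaBackgroundGaugeLetterDischarge.hletter_holds`) — literally the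
binder `hexB` of `NE7EtaBackgroundCloseness.hclose_of_covRoot_occ` with `σ_B = gaugeConst n·(N⁻¹ + N·b)`, `c₀ = sectorConst n`; no sup-form
regularity is read. [folklore] -/
theorem hexB_of_hminE {L N : ℕ} (hL : 2 ≤ L) (hN : 1 ≤ N) {θ : ℝ} (hθ6 : θ ^ 6 = ((L : ℝ))⁻¹) {ε b g : ℝ}
    (hb : 0 ≤ b) (hbε : b ≤ ε) {dom : Set (Site 4 → Fin 4 → (Matrix n n ℂ)ˣ)}
    (hminE : ∀ V ∈ dom, ∀ k : ℕ, ∃ U, IsMinimiser 4 (sfClass 4 L N ε) L N k V U ∧ Regular 4 L N b g k U) :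
    ∀ K : ℕ, 1 ≤ K → ∀ v ∈ dom, (Fintype.card n : ℝ) * (N : ℝ) ^ 2 * ε ≤ sectorConst n →
      ∃ UB : Site 4 → Fin 4 → (Matrix n n ℂ)ˣ, IsMinimiser 4 (sfClass 4 L N ε) L N (K + 1) v UB ∧ Regular 4 L N b g (K + 1) UB ∧
        ∃ uB : Site 4 → (Matrix n n ℂ)ˣ, IsUnitarySite uB ∧ IsPeriodicSite uB ((N * L ^ (K + 1) : ℕ) : ℤ) ∧
          ∃ AB : Site 4 → Fin 4 → Matrix n n ℂ, ∀ (x : Site 4) (κ : Fin 4),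
            ((gaugeAct uB UB x κ : (Matrix n n ℂ)ˣ) : Matrix n n ℂ) = exp (AB x κ) ∧
              ‖AB x κ‖ ≤ (gaugeConst n * (((N : ℝ))⁻¹ + (N : ℝ) * b)) * θ ^ (6 * (K + 1)) := by
  intro K hK v hv hsec
  obtain ⟨UB, hUB, hreg⟩ := hminE v hv (K + 1)
  obtain ⟨uB, hu, huP, AB, hAB⟩ := hletter_holds (dom := dom) hL hN hθ6 hb hbε K hK v hv UB hUB hreg hsec
  exact ⟨UB, hUB, hreg, uB, hu, huP, AB, hAB⟩

/-- **NODE O's `hclose` BINDER ON (H∃)ᴱ** — `NE7EtaBackgroundOfRegularMinimisers.hclose_of_hmin` (p312789) with the sup-form (H∃) `hmin`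
replaced by the energy-class (H∃)ᴱ `hminE` (`Regular 4 L N b g k`) and `gradConst 4 c ≤ g` replaced by `0 ≤ g`; every other hypothesis
(NE3's covariant root `h`, amendment 4 VERBATIM; `0 ≤ b ≤ ε`, `512·5·8·L²·b ≤ 1`, `16·C₀·ε ≤ 3`, `2·twoLevelSmall 4 L·ε ≤ L²`, `0 ≤ C`,
`0 < Λ₂′`, `hdom`, `hγ3`∕`hΛl₁`, the sector condition) and the CONCLUSION are VERBATIM those of p312789 (`hclose_of_covRoot_occ` ∘
`hexA_of_hminE` ∘ `hexB_of_hminE`).  NE3∕NE7 NOT proved. [folklore] -/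
theorem hclose_of_hminE {L N : ℕ} (hL : 2 ≤ L) (hN : 1 ≤ N) {θ : ℝ} (hθ : 0 < θ)
    (hθ6 : θ ^ 6 = ((L : ℝ))⁻¹) {ε b : ℝ} (hb : 0 ≤ b) (hbε : b ≤ ε)
    (hbs : 512 * (4 + 1) * (4 + 4) * (L : ℝ) ^ 2 * b ≤ 1)
    (hε1 : 16 * C0 4 * ε ≤ 3) (h2line : 2 * twoLevelSmall 4 L * ε ≤ (L : ℝ) ^ 2)
    {g C Λ₁ Λ₂' : ℝ} (hg : 0 ≤ g) (hC : 0 ≤ C) (hΛ₂' : 0 < Λ₂')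
    {dom : Set (Site 4 → Fin 4 → (Matrix n n ℂ)ˣ)}
    (hdom : ∀ v ∈ dom, ∀ w : Site 4 → (Matrix n n ℂ)ˣ, IsUnitarySite w → IsPeriodicSite w (N : ℤ) → gaugeAct w v ∈ dom)
    (hminE : ∀ V ∈ dom, ∀ k : ℕ, ∃ U, IsMinimiser 4 (sfClass 4 L N ε) L N k V U ∧ Regular 4 L N b g k U)
    (h : ∀ k : ℕ, 1 ≤ k → ∀ V ∈ dom, ∀ UA UB : Site 4 → Fin 4 → (Matrix n n ℂ)ˣ,
      IsMinimiser 4 (sfClass 4 L N ε) L N k V UA → IsMinimiser 4 (sfClass 4 L N ε) L N (k + 1) V UB →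
        Regular 4 L N b g (k + 1) UB →
        ∃ (u : Site 4 → (Matrix n n ℂ)ˣ) (Z : Site 4 → Fin 4 → Matrix n n ℂ),
          IsUnitarySite u ∧ IsPeriodicSite u ((N * L ^ k : ℕ) : ℤ) ∧
          IsSkewDir Z ∧ IsPeriodicDir Z ((N * L ^ k : ℕ) : ℤ) ∧
          gaugeAct u UA = vary (rescale L (bavg L UB)) Z 1 ∧
          energyNormW L k (rescale L (bavg L UB)) Z (periodBox (N * L ^ k)) ≤ C * residualScale 4 L N b g k ∧
          (∀ (κ : Fin 4) (x : Site 4) (μ : Fin 4),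
            ‖Ad (rescale L (bavg L UB) (x + e κ) μ) (Z (x + e μ) κ) - Z x κ‖ ≤ Λ₁ * (((L : ℝ)⁻¹) ^ k) ^ 2) ∧
          (∀ (κ μ : Fin 4) (y : Site 4),
            ‖Ad (rescale L (bavg L UB) (y + e κ) μ)
                (Ad (rescale L (bavg L UB) (y + e κ + e μ) μ) (Z (y + (2 : ℕ) • e μ) κ) - Z (y + e μ) κ)
              - (Ad (rescale L (bavg L UB) (y + e κ) μ) (Z (y + e μ) κ) - Z y κ)‖ ≤ Λ₂' * (((L : ℝ)⁻¹) ^ k) ^ 3))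
    {γ l₁ : ℝ} (hγ : 0 < γ)
    (hγ3 : C * (wallConst 4 L * (N : ℝ) ^ 2 * (Real.sqrt g * dualC2 4 L + 2 * b ^ 2 * dualC1 4 L)) ≤ γ ^ 3)
    (hl₁ : 0 < l₁) (hΛl₁ : Λ₁ ≤ l₁ ^ 3)
    (hsector : (Fintype.card n : ℝ) * (N : ℝ) ^ 2 * ε ≤ sectorConst n)
    (D : Type) (sc : D → ℕ) (dl : D → ℝ) (hdl : ∀ X, 0 ≤ dl X) :
    ∃ (uA : ℕ → (Site 4 → Fin 4 → (Matrix n n ℂ)ˣ) → (occCarriers n L N ε dom D sc dl hdl).BgA)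
      (uB : ℕ → (Site 4 → Fin 4 → (Matrix n n ℂ)ˣ) → (occCarriers n L N ε dom D sc dl hdl).BgB) (K₀ : ℕ) (C₃ : ℝ),
      0 ≤ C₃ ∧
      (∀ K : ℕ, K₀ ≤ K → ∀ v ∈ dom, ∃ (UA UB : Site 4 → Fin 4 → (Matrix n n ℂ)ˣ) (wA wB : Site 4 → (Matrix n n ℂ)ˣ),
        IsMinimiser 4 (sfClass 4 L N ε) L N K v UA ∧ IsMinimiser 4 (sfClass 4 L N ε) L N (K + 1) v UB ∧
        Regular 4 L N b g (K + 1) UB ∧ IsUnitarySite wA ∧ IsPeriodicSite wA ((N * L ^ K : ℕ) : ℤ) ∧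
        IsUnitarySite wB ∧ IsPeriodicSite wB ((N * L ^ (K + 1) : ℕ) : ℤ) ∧
        (uA K v).1 = (K, gaugeAct wA UA) ∧ (uB K v).1 = (K, gaugeAct wB UB)) ∧
      (∀ (K : ℕ) (v : Site 4 → Fin 4 → (Matrix n n ℂ)ˣ), ¬ (K₀ ≤ K ∧ v ∈ dom) →
        (uA K v).1 = (K, 1) ∧ (uB K v).1 = (K, 1)) ∧
      ∀ K : ℕ, ∀ v ∈ dom, (occCarriers n L N ε dom D sc dl hdl).gauge (uA K v)
          ((occCarriers n L N ε dom D sc dl hdl).transport (uB K v))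
        ≤ C₃ * θ ^ K := by
  have hε : 0 ≤ ε := hb.trans hbε
  have hN0 : (0 : ℝ) < N := by exact_mod_cast hN
  have hσB : 0 ≤ gaugeConst n * (((N : ℝ))⁻¹ + (N : ℝ) * b) := by
    have := (sectorConst_pos (n := n)).2
    positivity
  exact hclose_of_covRoot_occ hL hN hθ hθ6 hε (levelSmall_hls hL hε hε1 h2line) hb hbs hg hC hΛ₂' hdom h hγ hγ3 hl₁ hΛl₁
    (hexA_of_hminE hminE) hσB hsector (hexB_of_hminE hL hN hθ6 hb hbε hminE) D sc dl hdl

/-! ## §3 The `hclose` binder with the reference datum, on (H∃)ᴱ -/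

/-- **NODE O's `hclose` BINDER WITH A REFERENCE DATUM, ON (H∃)ᴱ** — `NE7EtaBackgroundReferenceWitness.hclose_of_hmin_ref` (p314477) with
`hmin` replaced by `hminE` and `gradConst 4 c ≤ g` by `0 ≤ g`: every trivial selection is the tag-`0` reference pair `refA = refB = (0,1)`,
the reference datum `v₁` selects it AT EVERY CUTOFF; the sign∕budget letters are shed by `covRoot_mono` (`γ := max (C⁺·ρ₄) 1`,
`l₁ := max Λ₁ 1`).  REMAINING HYPOTHESES: `2 ≤ L`, `1 ≤ N`, `0 < θ`, `θ⁶ = L⁻¹`, `0 ≤ b ≤ ε`, `512·5·8·L²·b ≤ 1`, `16·C₀·ε ≤ 3`,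
`2·twoLevelSmall 4 L·ε ≤ L²`, `0 ≤ g`, `hdom`, (H∃)ᴱ `hminE`, NE3's covariant root `h` (amendment 4 VERBATIM, ANY real `C, Λ₁, Λ₂′`), the
sector condition.  CONCLUSION VERBATIM that of p314477. [folklore] -/
theorem hclose_of_hminE_ref {L N : ℕ} (hL : 2 ≤ L) (hN : 1 ≤ N) {θ : ℝ} (hθ : 0 < θ)
    (hθ6 : θ ^ 6 = ((L : ℝ))⁻¹) {ε b : ℝ} (hb : 0 ≤ b) (hbε : b ≤ ε)
    (hbs : 512 * (4 + 1) * (4 + 4) * (L : ℝ) ^ 2 * b ≤ 1)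
    (hε1 : 16 * C0 4 * ε ≤ 3) (h2line : 2 * twoLevelSmall 4 L * ε ≤ (L : ℝ) ^ 2)
    {g C Λ₁ Λ₂' : ℝ} (hg : 0 ≤ g)
    {dom : Set (Site 4 → Fin 4 → (Matrix n n ℂ)ˣ)}
    (hdom : ∀ v ∈ dom, ∀ w : Site 4 → (Matrix n n ℂ)ˣ, IsUnitarySite w → IsPeriodicSite w (N : ℤ) → gaugeAct w v ∈ dom)
    (hminE : ∀ V ∈ dom, ∀ k : ℕ, ∃ U, IsMinimiser 4 (sfClass 4 L N ε) L N k V U ∧ Regular 4 L N b g k U)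
    (h : ∀ k : ℕ, 1 ≤ k → ∀ V ∈ dom, ∀ UA UB : Site 4 → Fin 4 → (Matrix n n ℂ)ˣ,
      IsMinimiser 4 (sfClass 4 L N ε) L N k V UA → IsMinimiser 4 (sfClass 4 L N ε) L N (k + 1) V UB →
        Regular 4 L N b g (k + 1) UB →
        ∃ (u : Site 4 → (Matrix n n ℂ)ˣ) (Z : Site 4 → Fin 4 → Matrix n n ℂ),
          IsUnitarySite u ∧ IsPeriodicSite u ((N * L ^ k : ℕ) : ℤ) ∧
          IsSkewDir Z ∧ IsPeriodicDir Z ((N * L ^ k : ℕ) : ℤ) ∧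
          gaugeAct u UA = vary (rescale L (bavg L UB)) Z 1 ∧
          energyNormW L k (rescale L (bavg L UB)) Z (periodBox (N * L ^ k)) ≤ C * residualScale 4 L N b g k ∧
          (∀ (κ : Fin 4) (x : Site 4) (μ : Fin 4),
            ‖Ad (rescale L (bavg L UB) (x + e κ) μ) (Z (x + e μ) κ) - Z x κ‖ ≤ Λ₁ * (((L : ℝ)⁻¹) ^ k) ^ 2) ∧
          (∀ (κ μ : Fin 4) (y : Site 4),
            ‖Ad (rescale L (bavg L UB) (y + e κ) μ)
                (Ad (rescale L (bavg L UB) (y + e κ + e μ) μ) (Z (y + (2 : ℕ) • e μ) κ) - Z (y + e μ) κ)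
              - (Ad (rescale L (bavg L UB) (y + e κ) μ) (Z (y + e μ) κ) - Z y κ)‖ ≤ Λ₂' * (((L : ℝ)⁻¹) ^ k) ^ 3))
    (hsector : (Fintype.card n : ℝ) * (N : ℝ) ^ 2 * ε ≤ sectorConst n)
    (v₁ : Site 4 → Fin 4 → (Matrix n n ℂ)ˣ)
    (D : Type) (sc : D → ℕ) (dl : D → ℝ) (hdl : ∀ X, 0 ≤ dl X) :
    ∃ (uA : ℕ → (Site 4 → Fin 4 → (Matrix n n ℂ)ˣ) → (occCarriers n L N ε dom D sc dl hdl).BgA)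
      (uB : ℕ → (Site 4 → Fin 4 → (Matrix n n ℂ)ˣ) → (occCarriers n L N ε dom D sc dl hdl).BgB) (K₀ : ℕ) (C₃ : ℝ),
      0 ≤ C₃ ∧
      (∀ K : ℕ, K₀ ≤ K → ∀ v ∈ dom, v ≠ v₁ → ∃ (UA UB : Site 4 → Fin 4 → (Matrix n n ℂ)ˣ) (wA wB : Site 4 → (Matrix n n ℂ)ˣ),
        IsMinimiser 4 (sfClass 4 L N ε) L N K v UA ∧ IsMinimiser 4 (sfClass 4 L N ε) L N (K + 1) v UB ∧
        Regular 4 L N b g (K + 1) UB ∧ IsUnitarySite wA ∧ IsPeriodicSite wA ((N * L ^ K : ℕ) : ℤ) ∧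
        IsUnitarySite wB ∧ IsPeriodicSite wB ((N * L ^ (K + 1) : ℕ) : ℤ) ∧
        (uA K v).1 = (K, gaugeAct wA UA) ∧ (uB K v).1 = (K, gaugeAct wB UB)) ∧
      (∀ (K : ℕ) (v : Site 4 → Fin 4 → (Matrix n n ℂ)ˣ), ¬ (K₀ ≤ K ∧ v ∈ dom ∧ v ≠ v₁) →
        uA K v = ⟨((0 : ℕ), (1 : Site 4 → Fin 4 → (Matrix n n ℂ)ˣ)), one_mem_occA L N ε dom 0⟩ ∧
        uB K v = ⟨((0 : ℕ), (1 : Site 4 → Fin 4 → (Matrix n n ℂ)ˣ)), one_mem_occB L N ε dom 0⟩) ∧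
      (∀ K : ℕ, uA K v₁ = ⟨((0 : ℕ), (1 : Site 4 → Fin 4 → (Matrix n n ℂ)ˣ)), one_mem_occA L N ε dom 0⟩ ∧
        uB K v₁ = ⟨((0 : ℕ), (1 : Site 4 → Fin 4 → (Matrix n n ℂ)ˣ)), one_mem_occB L N ε dom 0⟩) ∧
      ∀ K : ℕ, ∀ v ∈ dom, (occCarriers n L N ε dom D sc dl hdl).gauge (uA K v)
          ((occCarriers n L N ε dom D sc dl hdl).transport (uB K v))
        ≤ C₃ * θ ^ K := by
  classical
  -- shed the sign letters: the root with `C⁺ := max C 0`, `Λ₂″ := max Λ₂′ 1`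
  have hC' : 0 ≤ max C 0 := le_max_right _ _
  have hΛ₂'' : 0 < max Λ₂' 1 := lt_of_lt_of_le one_pos (le_max_right _ _)
  have h' := covRoot_mono (𝒞 := sfClass 4 L N ε) (le_max_left C 0) (le_refl Λ₁) (le_max_left Λ₂' 1) h
  -- shed the budget letters: choose `γ`, `l₁`
  set ρ₄ : ℝ := wallConst 4 L * (N : ℝ) ^ 2 * (Real.sqrt g * dualC2 4 L + 2 * b ^ 2 * dualC1 4 L) with hρ₄
  set γ : ℝ := max (max C 0 * ρ₄) 1 with hγdef
  have hγ1 : 1 ≤ γ := le_max_right _ _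
  have hγ3 : max C 0 * ρ₄ ≤ γ ^ 3 := (le_max_left _ _).trans (le_self_pow₀ hγ1 (by norm_num))
  set l₁ : ℝ := max Λ₁ 1 with hl₁def
  have hl₁1 : 1 ≤ l₁ := le_max_right _ _
  have hΛl₁ : Λ₁ ≤ l₁ ^ 3 := (le_max_left _ _).trans (le_self_pow₀ hl₁1 (by norm_num))
  -- the chain on (H∃)ᴱ
  obtain ⟨uA, uB, K₀, C₃, hC₃, hspec, hoff, hclose⟩ := hclose_of_hminE hL hN hθ hθ6 hb hbε hbs hε1 h2line hg hC' hΛ₂'' hdom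
    hminE h' (lt_of_lt_of_le one_pos hγ1) hγ3 (lt_of_lt_of_le one_pos hl₁1) hΛl₁ hsector D sc dl hdl
  -- the re-cut selections
  refine ⟨fun K v => if K₀ ≤ K ∧ v ∈ dom ∧ v ≠ v₁ then uA K v
      else ⟨((0 : ℕ), (1 : Site 4 → Fin 4 → (Matrix n n ℂ)ˣ)), one_mem_occA L N ε dom 0⟩,
    fun K v => if K₀ ≤ K ∧ v ∈ dom ∧ v ≠ v₁ then uB K v
      else ⟨((0 : ℕ), (1 : Site 4 → Fin 4 → (Matrix n n ℂ)ˣ)), one_mem_occB L N ε dom 0⟩, K₀, C₃, hC₃, ?_, ?_, ?_, ?_⟩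
  · -- (a) gauge copies of a minimiser pair for the datum itself, off the reference datum
    intro K hK v hv hne
    have hKv : K₀ ≤ K ∧ v ∈ dom ∧ v ≠ v₁ := ⟨hK, hv, hne⟩
    obtain ⟨UA, UB, wA, wB, hA, hB, hreg, hwAu, hwAp, hwBu, hwBp, heA, heB⟩ := hspec K hK v hv
    refine ⟨UA, UB, wA, wB, hA, hB, hreg, hwAu, hwAp, hwBu, hwBp, ?_, ?_⟩
    · simp only [if_pos hKv]; exact heA
    · simp only [if_pos hKv]; exact heB
  · -- (b) the reference pair otherwise
    intro K v hKv
    exact ⟨by simp only [if_neg hKv], by simp only [if_neg hKv]⟩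
  · -- (b′) the reference datum reads the reference pair at every cutoff
    intro K
    have hKv : ¬ (K₀ ≤ K ∧ v₁ ∈ dom ∧ v₁ ≠ v₁) := fun h => h.2.2 rfl
    exact ⟨by simp only [if_neg hKv], by simp only [if_neg hKv]⟩
  · -- (c) `hclose`
    intro K v hv
    by_cases hKv : K₀ ≤ K ∧ v ∈ dom ∧ v ≠ v₁
    · simp only [if_pos hKv]
      exact hclose K v hv
    · simp only [if_neg hKv]
      rw [gauge_refPair]
      positivity

end

end Summit.QuantumFields.BalabanUV.T4Continuum.NE7EtaBackgroundEnergyClass
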